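import Literature.AlgebraicGeometry.Motives.MumfordTateInvariantsLieStabilizer
import Literature.AlgebraicGeometry.Motives.MumfordTateInvariantsTorusPoints
import Literature.AlgebraicGeometry.Motives.MumfordTateInvariantsSemisimple
import HarnessLib

/-!
# Rational torus elements of the Mumford–Tate group (Mumford–Tate invariants, step 10)

Let `H` be a pure `ℚ`-Hodge structure on a finite-dimensional `V` and let `S ∈ 𝔰 = lieStabilizer H`
be SEMISIMPLE, with complex eigenbasis `b` of `V_ℂ` and eigenvalues `ev i` (roots of `minpoly ℚ S`).
From the rational torus points `P₀` of `MumfordTateInvariantsTorusPoints.lean` we build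
`g = P₀(S) ∈ GL(V)(ℚ)` and prove `g ∈ MT(H)(ℚ) = H.mumfordTateGroup` (`exists_torusElement`):
on the tensor basis `hodgeTensorBasis b a b`, `ρ(S_ℂ)` has eigenvalue
`κ(x) = Σ ev(β) - Σ ev(γ) = Σ_μ w_x(μ) μ` and `g_ℂ` has eigenvalue `c(x) = ∏_μ U(μ)^{w_x(μ)}`
(`U(μ) = P₀(μ)`, `w_x` the weight vector); a weight-`0` Hodge tensor `t₀` is killed by `ρ(S)`
(`S ∈ 𝔰`), so its complexification lies in the span of the `x` with `κ(x) = 0`, on which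
`c(x) = 1` because the values `U` satisfy every multiplicative relation attached to an additive
relation among the roots. At the same time `c` can be required to violate finitely many prescribed
relations (`∏ U^{M} ≠ 1` for `Σ M(μ) μ ≠ 0`), which is how `g` will MOVE a non-Hodge tensor, resp.
separate the eigenspaces of `ρ(S)`, in the proof of `Deligne1982_mumfordTateInvariants`.

This realises, for the semisimple directions of `𝔰`, the classical fact that the rational points
of a connected `ℚ`-group are Zariski dense (Borel, *Linear Algebraic Groups*, 18.3 with 7.3,
8.13–8.14), which is what allows Deligne's statements about the algebraic group `MT` (LNM 900, I,
Prop. 3.4, 3.6) to be read on `ℚ`-points.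

## References

* A. Borel, *Linear Algebraic Groups*, 2nd ed., GTM 126 (1991), §7.3, 8.13–8.14, 18.2–18.3.
* P. Deligne, *Hodge cycles on abelian varieties*, LNM 900 (1982), I §3, Prop. 3.4.
-/

noncomputable section

open scoped TensorProduct
open Polynomial

namespace Literature.AlgebraicGeometry.Motives

namespace HodgeStructure

universe u v

variable {V : Type u} [AddCommGroup V] [Module ℚ V] [Module.Finite ℚ V] [HodgeTensorFacts.{u, u}]
  {n : ℤ}

omit [HodgeTensorFacts.{u, u}] in
/-- A rational endomorphism whose complexification is diagonal with non-zero eigenvalues in some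
basis of `V_ℂ` is an automorphism. [folklore] -/
theorem bijective_of_baseChange_diag {ι : Type v} (b : Module.Basis ι ℂ (ℂ ⊗[ℚ] V))
    {u : Module.End ℚ V} {d : ι → ℂ} (hu : ∀ i, u.baseChange ℂ (b i) = d i • b i)
    (hd : ∀ i, d i ≠ 0) : Function.Bijective u := by
  have hinj : Function.Injective u := by
    intro v w hvw
    rw [← sub_eq_zero, ← map_sub] at hvw
    rw [← sub_eq_zero]
    apply one_tmul_injective (M := V)
    change (1 : ℂ) ⊗ₜ[ℚ] (v - w) = (1 : ℂ) ⊗ₜ[ℚ] 0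
    rw [TensorProduct.tmul_zero]
    have h0 : u.baseChange ℂ ((1 : ℂ) ⊗ₜ[ℚ] (v - w)) = 0 := by
      rw [LinearMap.baseChange_tmul, hvw, TensorProduct.tmul_zero]
    rw [← b.repr.injective.eq_iff, map_zero]
    ext i
    have h := basisRepr_apply_of_diag b hu ((1 : ℂ) ⊗ₜ[ℚ] (v - w)) i
    rw [h0, map_zero, Finsupp.zero_apply] at h
    exact (mul_eq_zero.1 h.symm).resolve_left (hd i)
  exact ⟨hinj, LinearMap.injective_iff_surjective.1 hinj⟩

omit [Module.Finite ℚ V] [HodgeTensorFacts.{u, u}] in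
/-- The eigenvalue of `ρ(S_ℂ)` on the tensor basis vector indexed by `x` is the weighted root sum
`Σ_μ w_x(μ) μ`. [folklore] -/
theorem tensorDerivation_eigenvalue_eq_sum_tensorWeight {ι : Type v} {R : Type*} [Fintype R]
    [DecidableEq R] (ev : ι → R) (val : R → ℂ) {a b : ℕ} (x : (Fin a → ι) × (Fin b → ι)) :
    ((∑ k, val (ev (x.1 k))) - ∑ l, val (ev (x.2 l))) = ∑ μ, tensorWeight ev x μ • val μ :=
  (sum_tensorWeight_smul ev x val).symm

/-- **Rational torus elements of the Mumford–Tate group.** Let `S ∈ 𝔰` be semisimple with complex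
eigenbasis `b`, eigenvalues `ev i` (roots of `minpoly ℚ S`), and let finitely many weight vectors
`M` on the roots with `Σ M(μ) μ ≠ 0` be given. Then there are `g ∈ MT(H)(ℚ)` and non-zero values
`U(μ)` such that `g_ℂ (b i) = U(ev i) • b i`, `∏ U(μ)^{M(μ)} = 1` whenever `Σ M(μ) μ = 0`, and
`∏ U(μ)^{M(μ)} ≠ 1` for the given `M`. (`g = P₀(S)` for the rational torus point `P₀` of
`exists_polynomial_torusPoint`; membership in `MT`: a weight-`0` Hodge tensor is killed by
`ρ(S)`, hence lies in the span of the tensor basis vectors with `Σ_μ w_x(μ) μ = 0`, on which `g`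
acts by `∏ U^{w_x} = 1`.) [folklore] -/
theorem exists_torusElement (H : HodgeStructure V n) {S : Module.End ℚ V}
    (hS : S ∈ H.lieStabilizer) (hSss : S.IsSemisimple) {ι : Type v} [Fintype ι]
    (b : Module.Basis ι ℂ (ℂ ⊗[ℚ] V)) (ev : ι → (minpoly ℚ S).rootSet ℂ)
    (hb : ∀ i, S.baseChange ℂ (b i) = ((ev i : ℂ)) • b i)
    (𝓜 : Finset ((minpoly ℚ S).rootSet ℂ → ℤ))
    (h𝓜 : ∀ M ∈ 𝓜, ∑ μ : (minpoly ℚ S).rootSet ℂ, M μ • (μ : ℂ) ≠ 0) :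
    ∃ (g : V ≃ₗ[ℚ] V) (U : (minpoly ℚ S).rootSet ℂ → ℂ),
      g ∈ H.mumfordTateGroup ∧
      (∀ i, (g : V →ₗ[ℚ] V).baseChange ℂ (b i) = U (ev i) • b i) ∧
      (∀ μ, U μ ≠ 0) ∧
      (∀ M : (minpoly ℚ S).rootSet ℂ → ℤ, ∑ μ, M μ • (μ : ℂ) = 0 → ∏ μ, U μ ^ M μ = 1) ∧
      ∀ M ∈ 𝓜, ∏ μ, U μ ^ M μ ≠ 1 := by
  classical
  have hsep : (minpoly ℚ S).Separable :=
    PerfectField.separable_iff_squarefree.2 hSss.minpoly_squarefree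
  have hE : ((minpoly ℚ S).map (algebraMap ℚ ℂ)).Splits := IsAlgClosed.splits _
  obtain ⟨P₀, hU0, hrel, hsep'⟩ := exists_polynomial_torusPoint hsep hE 𝓜 h𝓜
  set U : (minpoly ℚ S).rootSet ℂ → ℂ := fun μ => aeval (μ : ℂ) P₀ with hU_def
  set u : Module.End ℚ V := aeval S P₀ with hu_def
  -- `u_ℂ` is diagonal in `b` with eigenvalues `U (ev i)`
  have hub : ∀ i, u.baseChange ℂ (b i) = U (ev i) • b i := by
    intro i
    rw [hu_def, baseChange_aeval, Module.End.aeval_apply_of_mem_apply_eq_smul (hb i), eval_map,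
      ← aeval_def]
  obtain ⟨hinj, hsurj⟩ := bijective_of_baseChange_diag b hub fun i => hU0 (ev i)
  set g : V ≃ₗ[ℚ] V := LinearEquiv.ofBijective u ⟨hinj, hsurj⟩ with hg_def
  have hgu : (g : V →ₗ[ℚ] V) = u := rfl
  refine ⟨g, U, ?_, fun i => by rw [hgu, hub], hU0, hrel, hsep'⟩
  -- membership in the Mumford–Tate group
  rw [mem_mumfordTateGroup_iff]
  intro a b' hab t₀ ht₀
  apply tensorSpaceToBaseChange_injective V a b'
  rw [tensorSpaceToBaseChange_tensorSpaceAct]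
  -- eigenvalues of `ρ(S_ℂ)` and of `g_ℂ` on the tensor basis
  have hdiagS : ∀ x : (Fin a → ι) × (Fin b' → ι),
      tensorDerivation a b' (S.baseChange ℂ) (hodgeTensorBasis b a b' x) =
        (∑ μ, tensorWeight ev x μ • (μ : ℂ)) • hodgeTensorBasis b a b' x := fun x => by
    rw [tensorDerivation_hodgeTensorBasis' b hb x,
      tensorDerivation_eigenvalue_eq_sum_tensorWeight ev (fun μ => (μ : ℂ)) x]
  have hgb : ∀ i, (g.baseChange ℚ ℂ V V) (b i) = U (ev i) • b i := fun i => by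
    change (g : V →ₗ[ℚ] V).baseChange ℂ (b i) = _
    rw [hgu, hub]
  have hdiagG : ∀ x : (Fin a → ι) × (Fin b' → ι),
      (tensorSpaceActOver (a := a) (b := b') (g.baseChange ℚ ℂ V V)).toLinearMap
          (hodgeTensorBasis b a b' x) =
        (∏ μ, U μ ^ tensorWeight ev x μ) • hodgeTensorBasis b a b' x := fun x => by
    rw [tensorSpaceActOver_hodgeTensorBasis' b hgb x, prod_zpow_tensorWeight ev x hU0]
  -- the complexified Hodge tensor is killed by `ρ(S_ℂ)`
  have hker : tensorSpaceToBaseChange ℂ V a b' t₀ ∈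
      LinearMap.ker (tensorDerivation a b' (S.baseChange ℂ)) := by
    rw [LinearMap.mem_ker, ← hodgeTensorSpaceBaseChange_one_tmul,
      ← hodgeTensorSpaceBaseChange_tensorDerivation, LinearMap.baseChange_tmul,
      (H.mem_lieStabilizer_iff S).1 hS a b' hab t₀ ht₀, TensorProduct.tmul_zero, map_zero]
  have hspan := @ker_eq_span_of_diag ℂ _ (hodgeTensorSpaceOver ℂ (ℂ ⊗[ℚ] V) a b') _ _
    ((Fin a → ι) × (Fin b' → ι)) (hodgeTensorBasis b a b') (tensorDerivation a b' (S.baseChange ℂ))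
    (fun x => ∑ μ, tensorWeight ev x μ • (μ : ℂ)) hdiagS _
  rw [hspan] at hker
  -- on that span `g_ℂ` acts trivially
  have key : ∀ s ∈ Submodule.span ℂ
      (hodgeTensorBasis b a b' '' {x | ∑ μ, tensorWeight ev x μ • (μ : ℂ) = 0}),
      tensorSpaceActOver (g.baseChange ℚ ℂ V V) s = s := by
    intro s hs
    induction hs using Submodule.span_induction with
    | mem s hs =>
      obtain ⟨x, hx, rfl⟩ := hs
      have h := hdiagG x
      rw [LinearEquiv.coe_coe] at h
      rw [h, hrel _ hx, one_smul]
    | zero => exact map_zero _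
    | add x y _ _ hx hy => rw [map_add, hx, hy]
    | smul c x _ hx => rw [map_smul, hx]
  exact key _ hker

end HodgeStructure

end Literature.AlgebraicGeometry.Motives

end
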